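import Mathlib
import Summits.Schanuel.Schanuel.Theorems.AclSubsetLogFreeCore.Negative.ExpAclDefinability

/-!
# Line `kernel-tower-relative-lw` (route `RigidCore`): `RelLW₀` at `u = (cπ)` — `e^{cπ}` is transcendental over `L₀` (Nesterenko)

Registered stub `stub_relLWZero_ratPi` of line `kernel-tower-relative-lw` of crux
`stmt-Schanuel-0970` (`Summit.Schanuel.Schanuel.Theses.RigidCore.SchanuelOnLogFreeCore`).
The level-`0` layer `RelLW₀` of the line says: exponentials of elements of
`L₀ = stage 0 = ℚ(2πi)^{ralg}` (the tree tower of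
`Theorems/AclSubsetLogFreeCore/Negative/LogFreeCoreObjects.lean`) that are `ℚ`-independent modulo
`ℚ·2πi` are algebraically independent OVER `L₀`.  This file proves its instance class
`u = (cπ)`, `c ∈ ℚ ∖ {0}`: `e^{cπ}` is transcendental over `L₀` — i.e. the one-element family
`(e^{cπ})` is algebraically independent over `stage 0` (`stub_relLWZero_ratPi`, signature verbatim).

Proof.  First `L₀ = ℚ(π)^{ralg}`: `stage 0 = Kpi` (`KernelTower.stage_zero_eq_Kpi`; `2πi ∈ Kpi`,
`π = 2πi/(2i) ∈ stage 0`, and both fields are relatively algebraically closed in `ℂ`).  Then, by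
Nesterenko (`π ⊥ e^π`, tree theorem `nesterenko_holds`, here through `exp_pi_not_mem_Kpi`):
`e^{nπ} ∉ Kpi` for `n ≥ 1` (else `e^π`, a root of `X^n − e^{nπ} ∈ Kpi[X]`, lies in `Kpi`);
`e^{zπ} ∉ Kpi` for `z ∈ ℤ ∖ {0}` (`e^{−nπ} = (e^{nπ})⁻¹`); `e^{cπ} ∉ Kpi` for `c ∈ ℚ ∖ {0}`
(`(e^{cπ})^{den c} = e^{num c · π}`).  As `stage 0` is relatively algebraically closed,
`e^{cπ}` is transcendental over `stage 0` (`KernelTower.transcendental_stage_zero_exp_rat_mul_pi`),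
which for a one-element family is algebraic independence (`algebraicIndependent_unique_type_iff`).

Quotable forms: `KernelTower.stage_zero_le_Kpi`, `KernelTower.Kpi_le_stage_zero`,
`KernelTower.stage_zero_eq_Kpi`, `KernelTower.exp_rat_mul_pi_not_mem_Kpi`,
`KernelTower.exp_rat_mul_pi_not_mem_stage_zero`,
`KernelTower.transcendental_stage_zero_exp_rat_mul_pi`.  Everything is proved (no named facts;
the only transcendence input is the PROVED tree theorem `nesterenko_holds` via
`exp_pi_not_mem_Kpi`).  NOT claimed: any other instance of `RelLW₀` (e.g. `u = (1)`, which is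
`e ⊥ π`, open).

## References

* [Nesterenko1996SbMath] Yu. V. Nesterenko, *Modular functions and transcendence questions*,
  Sb. Math. 187 (1996) 1319–1348, Theorem 1 (`π, e^π, Γ(1/4)` algebraically independent;
  tree theorem `nesterenko_holds`).
-/

noncomputable section

namespace Summit.Schanuel.Schanuel.Theorems.RigidCore

open Summit.Schanuel.Schanuel.Theorems.AclSubsetLogFreeCore.Negative

/-! ### `L₀ = stage 0 = ℚ(2πi)^{ralg}` equals `Kpi = ℚ(π)^{ralg}` -/

/-- `stage 0 = ℚ(2πi)^{ralg} ≤ ℚ(π)^{ralg}`: `2πi ∈ Kpi` and `Kpi` is relatively algebraically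
closed in `ℂ`. [folklore] -/
theorem KernelTower.stage_zero_le_Kpi : stage 0 ≤ Kpi := by
  intro x hx
  have hx' : x ∈ relAlg (IntermediateField.adjoin ℚ {(2 * ↑Real.pi * Complex.I : ℂ)}) := hx
  rw [mem_relAlg_iff] at hx'
  have hle : IntermediateField.adjoin ℚ {(2 * ↑Real.pi * Complex.I : ℂ)} ≤ Kpi :=
    IntermediateField.adjoin_simple_le_iff.2 two_pi_I_mem_Kpi
  exact Kpi_mem_coreFamilyNoExp.2 x (isAlgebraic_of_le hle hx')

/-- `i ∈ stage 0` (`i` is algebraic over `ℚ`, `stage 0` is relatively algebraically closed).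
[folklore] -/
theorem KernelTower.I_mem_stage_zero : Complex.I ∈ stage 0 := by
  have hI : IsAlgebraic ℚ Complex.I :=
    IsAlgebraic.of_pow two_pos (by rw [Complex.I_sq]; exact isAlgebraic_one.neg)
  exact stage_closed 0 _ (hI.tower_top (L := ↥(stage 0)))

/-- `π = 2πi / (i + i) ∈ stage 0`. [folklore] -/
theorem KernelTower.pi_mem_stage_zero : (Real.pi : ℂ) ∈ stage 0 := by
  have h := div_mem two_pi_I_mem_stage_zero
    (add_mem KernelTower.I_mem_stage_zero KernelTower.I_mem_stage_zero)
  have e : (2 * ↑Real.pi * Complex.I : ℂ) / (Complex.I + Complex.I) = Real.pi := by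
    rw [← two_mul, show (2 * ↑Real.pi * Complex.I : ℂ) = ↑Real.pi * (2 * Complex.I) by ring]
    exact mul_div_cancel_right₀ _ (mul_ne_zero two_ne_zero Complex.I_ne_zero)
  rwa [e] at h

/-- `ℚ(π)^{ralg} ≤ stage 0`: `π ∈ stage 0` and `stage 0` is relatively algebraically closed in
`ℂ`. [folklore] -/
theorem KernelTower.Kpi_le_stage_zero : Kpi ≤ stage 0 := by
  intro x hx
  rw [Kpi, mem_relAlg_iff] at hx
  have hle : IntermediateField.adjoin ℚ {(Real.pi : ℂ)} ≤ stage 0 :=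
    IntermediateField.adjoin_simple_le_iff.2 KernelTower.pi_mem_stage_zero
  exact stage_closed 0 x (isAlgebraic_of_le hle hx)

/-- **`L₀ = ℚ(π)^{ralg}`**: the level-`0` field of the kernel tower, `stage 0 = ℚ(2πi)^{ralg}`, is
the relative algebraic closure `Kpi` of `ℚ(π)` in `ℂ`. [folklore] -/
theorem KernelTower.stage_zero_eq_Kpi : stage 0 = Kpi :=
  le_antisymm KernelTower.stage_zero_le_Kpi KernelTower.Kpi_le_stage_zero

/-- Membership form of `stage 0 = Kpi`. [folklore] -/
theorem KernelTower.mem_stage_zero_iff_mem_Kpi {x : ℂ} : x ∈ stage 0 ↔ x ∈ Kpi := by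
  rw [KernelTower.stage_zero_eq_Kpi]

/-- Membership in `L₀ = stage 0` is algebraicity over `ℚ(π)`. [folklore] -/
theorem KernelTower.mem_stage_zero_iff_isAlgebraic_adjoin_pi {x : ℂ} :
    x ∈ stage 0 ↔ IsAlgebraic (IntermediateField.adjoin ℚ {(Real.pi : ℂ)}) x := by
  rw [KernelTower.stage_zero_eq_Kpi]
  exact mem_relAlg_iff

/-! ### `e^{nπ}, e^{zπ}, e^{cπ} ∉ ℚ(π)^{ralg}` (Nesterenko) -/

/-- `e^{nπ} ∉ ℚ(π)^{ralg}` for `n ≥ 1`: otherwise `e^π`, a root of `X^n − e^{nπ} ∈ Kpi[X]`, would be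
algebraic over `Kpi`, hence in `Kpi` — contradicting Nesterenko (`exp_pi_not_mem_Kpi`).
[cite: Nesterenko1996SbMath, Theorem 1] -/
theorem KernelTower.exp_nat_mul_pi_not_mem_Kpi (n : ℕ) (hn : 0 < n) :
    Complex.exp ((n : ℂ) * ↑Real.pi) ∉ Kpi := by
  intro h
  rw [Complex.exp_nat_mul] at h
  have halg : IsAlgebraic Kpi (Complex.exp ↑Real.pi ^ n) :=
    isAlgebraic_algebraMap (⟨Complex.exp ↑Real.pi ^ n, h⟩ : Kpi)
  exact exp_pi_not_mem_Kpi (Kpi_mem_coreFamilyNoExp.2 _ (IsAlgebraic.of_pow hn halg))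

/-- `e^{zπ} ∉ ℚ(π)^{ralg}` for `z ∈ ℤ ∖ {0}` (`e^{−nπ} = (e^{nπ})⁻¹` and `Kpi` is a field).
[cite: Nesterenko1996SbMath, Theorem 1] -/
theorem KernelTower.exp_int_mul_pi_not_mem_Kpi (z : ℤ) (hz : z ≠ 0) :
    Complex.exp ((z : ℂ) * ↑Real.pi) ∉ Kpi := by
  intro h
  obtain ⟨n, rfl | rfl⟩ := Int.eq_nat_or_neg z
  · have hn : n ≠ 0 := by exact_mod_cast hz
    rw [Int.cast_natCast] at h
    exact KernelTower.exp_nat_mul_pi_not_mem_Kpi n (Nat.pos_of_ne_zero hn) h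
  · have hn : n ≠ 0 := by exact_mod_cast (neg_ne_zero.1 hz)
    rw [Int.cast_neg, Int.cast_natCast, neg_mul, Complex.exp_neg] at h
    exact KernelTower.exp_nat_mul_pi_not_mem_Kpi n (Nat.pos_of_ne_zero hn) (inv_mem_iff.1 h)

/-- `den c · (c π) = num c · π` in `ℂ`. [folklore] -/
theorem KernelTower.den_mul_rat_mul_pi (c : ℚ) :
    (c.den : ℂ) * ((c : ℂ) * ↑Real.pi) = (c.num : ℂ) * ↑Real.pi := by
  have h : ((c * c.den : ℚ) : ℂ) = ((c.num : ℚ) : ℂ) := by rw [Rat.mul_den_eq_num]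
  push_cast at h
  rw [← h]
  ring

/-- `e^{cπ} ∉ ℚ(π)^{ralg}` for `c ∈ ℚ ∖ {0}`: `(e^{cπ})^{den c} = e^{num c · π}` and `Kpi` is closed
under powers. [cite: Nesterenko1996SbMath, Theorem 1] -/
theorem KernelTower.exp_rat_mul_pi_not_mem_Kpi (c : ℚ) (hc : c ≠ 0) :
    Complex.exp ((c : ℂ) * ↑Real.pi) ∉ Kpi := by
  intro h
  have hpow := pow_mem h c.den
  rw [← Complex.exp_nat_mul, KernelTower.den_mul_rat_mul_pi] at hpow
  exact KernelTower.exp_int_mul_pi_not_mem_Kpi c.num (Rat.num_ne_zero.2 hc) hpow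

/-- `e^{cπ} ∉ L₀ = stage 0` for `c ∈ ℚ ∖ {0}` (Nesterenko, through `stage 0 ≤ Kpi`).
[cite: Nesterenko1996SbMath, Theorem 1] -/
theorem KernelTower.exp_rat_mul_pi_not_mem_stage_zero (c : ℚ) (hc : c ≠ 0) :
    Complex.exp ((c : ℂ) * ↑Real.pi) ∉ stage 0 := fun h =>
  KernelTower.exp_rat_mul_pi_not_mem_Kpi c hc (KernelTower.stage_zero_le_Kpi h)

/-- `e^{cπ}` is transcendental over `L₀ = stage 0` for `c ∈ ℚ ∖ {0}` (`stage 0` is relatively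
algebraically closed in `ℂ` and misses `e^{cπ}`). [cite: Nesterenko1996SbMath, Theorem 1] -/
theorem KernelTower.transcendental_stage_zero_exp_rat_mul_pi (c : ℚ) (hc : c ≠ 0) :
    Transcendental (↥(stage 0)) (Complex.exp ((c : ℂ) * ↑Real.pi)) := by
  intro h
  exact KernelTower.exp_rat_mul_pi_not_mem_stage_zero c hc (stage_closed 0 _ h)

/-- **Stub `stub_relLWZero_ratPi` of line `kernel-tower-relative-lw`** (registered on
`stmt-Schanuel-0970`, signature verbatim): the instance class `u = (cπ)`, `c ∈ ℚ ∖ {0}`, of the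
level-`0` relative Lindemann–Weierstrass layer `RelLW₀` — the one-element family `(e^{cπ})` is
algebraically independent over `L₀ = stage 0 = ℚ(2πi)^{ralg}`, i.e. `e^{cπ}` is transcendental over
`ℚ(π)^{ralg}` (Nesterenko: `π ⊥ e^π`). [cite: Nesterenko1996SbMath, Theorem 1] -/
theorem stub_relLWZero_ratPi :
    ∀ c : ℚ, c ≠ 0 →
      AlgebraicIndependent (↥(stage 0)) (fun _ : Fin 1 => Complex.exp ((c : ℂ) * ↑Real.pi)) := by
  intro c hc
  rw [algebraicIndependent_unique_type_iff]
  exact KernelTower.transcendental_stage_zero_exp_rat_mul_pi c hc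

end Summit.Schanuel.Schanuel.Theorems.RigidCore

end
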